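import Summits.CriticalPhenomena.PercolationContinuityZ3.Theorems.PercNearOneGluingNoHeavyConstsMDLXJointMarker
import HarnessLib

/-!
# MDL(X)′ at a vertex functional `1{s ↔ a}` is a 2×2 minor of the avoidance kernel of ONE source
# ("avoidance-enlargement marker dominance"; PAPER-2 track (ii): constants of the CSH family; seat `prim-consts-2`, gen 12)

builds on p205010 (kernel theorem, internal audit signed; external expert review pending).  Support file (`--supports
stmt-CriticalPhenomena-4575`); memo `run/shared/lean/prim/consts/FROM-prim-consts-2-g12-EDGE-GIBBS.md` §2.  No definitions, no named facts,
no sorries.  Companion of `…ConstsMDLXJointCylinder.lean` (gen 11: the cylinder functionals `1{C ⊆ C_s}` reduce `Consts.MDLXJoint` to the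
two-SOURCE kernel form R(S)) — this file is the dual normal form for the vertex functionals `F = 1{a ∈ V(C_s)}` (memo g11 §0(6): "V5",
no static van den Berg–Häggström–Kahn certificate, kit j160472; 0 violations in every census).

Notation: owner `s`, avoided set `X`, markers `y, z`, a vertex `a`; `K_A := μ(s ↮ A) = μ{ω | ∀ b ∈ A, s ↮ b}` (one row of the avoidance
kernel), `D = {s ↮ X}` (`μ(D) = K_X`), `T = {y ↮ {s}∪X} ∩ D`, `W = {y ↔ z}`.

* `Consts.real_avoid_inter_conn_eq` — `μ(D ∩ {s↔a}) = K_X − K_{X∪{a}}`;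
  `Consts.real_avoid_inter_conn_inter_conn_eq` — `μ(D ∩ {s↔a} ∩ {s↔t}) = K_X − K_{X∪{a}} − K_{X∪{t}} + K_{X∪{a,t}}` (inclusion–exclusion).
* `Consts.covD_connIndicator_eq_minor` — **the identity**
  `cov_D(1{s↔a}; s↔t) := μ(D)·μ(D ∩ {s↔a} ∩ {s↔t}) − μ(D ∩ {s↔a})·μ(D ∩ {s↔t}) = K_X·K_{X∪{a,t}} − K_{X∪{a}}·K_{X∪{t}} =: f_a(t)`,
  the 2×2 minor of the row `A ↦ K_A` at the square `{X, X∪a, X∪t, X∪{a,t}}` — nonnegative by van den Berg–Häggström–Kahn's Theorem 1.1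
  (log-supermodularity of `A ↦ μ(s ↮ A)`), which is not used here.
* `Consts.mdlxJoint_at_connIndicator_iff_minor` — hence the `Consts.MDLXJoint` inequality at `F = connIndicatorFn s a` (`F(C_s) = 1{s↔a}`)
  is EQUIVALENT to the five-point inequality  **AEMD(a):  `μ(T∩W)·f_a(y) ≤ μ(T)·f_a(z)`**, i.e.
  `[P(s↮z | s↮X∪a) − P(s↮z | s↮X)]·μ(T) ≥ [P(s↮y | s↮X∪a) − P(s↮y | s↮X)]·μ(T∩W)`: enlarging the AVOIDED set by one vertex costs the
  owner at `z` at least `p' = P(y↔z | T)` times what it costs at `y`.  For `X = ∅` this is the tree's MDL(∅) at `1{s↔a}`; `a = y`, `a = z` are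
  the marker theorems (`Consts.mdlxJoint_at_connIndicator`, `…_z`); the general case is open (census: 0 violations, memo §2; it holds moreover
  with the constant `p'(X∪{a})` of the larger avoided set, memo §3).  Dual to the source-enlargement form R(S) of the cylinder file, where the
  2×2 minor has two sources `s ⊂ S` and the fixed avoided set `X`.
[cite: VandenbergHaggstromKahn2005, Thm. 1.1 (p. 3), Thm. 1.3 (p. 6), §2.1 (pp. 9–13)]
-/

noncomputable section

namespace Summit.CriticalPhenomena.PercolationContinuityZ3.Theorems

open MeasureTheory Set Literature.Probability.LatticeModels Literature.Probability.Percolation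
open scoped Classical

namespace Consts

variable {V : Type*} [Fintype V]

omit [Fintype V] in
/-- `{s ↮ X} ∩ {s ↔ a} = {s ↮ X} ∖ {s ↮ X ∪ {a}}`. [folklore] -/
theorem avoid_inter_conn_eq_diff (s a : V) (X : Set V) :
    ({ω : BondConfig V | ∀ x ∈ X, ¬ (openGraph ω).Reachable s x} ∩ openConn s a) =
      {ω : BondConfig V | ∀ x ∈ X, ¬ (openGraph ω).Reachable s x} \
        {ω : BondConfig V | ∀ x ∈ insert a X, ¬ (openGraph ω).Reachable s x} := by
  ext ω
  constructor
  · rintro ⟨hX, ha⟩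
    exact ⟨hX, fun hXa => hXa a (mem_insert a X) ha⟩
  · rintro ⟨hX, hnXa⟩
    refine ⟨hX, ?_⟩
    by_contra hna
    apply hnXa
    intro x hx
    rcases mem_insert_iff.1 hx with rfl | hx'
    · exact hna
    · exact hX x hx'

/-- **`μ(D ∩ {s↔a}) = K_X − K_{X∪{a}}`** (`D = {s↮X}`, `K_A = μ(s↮A)`). [folklore] -/
theorem real_avoid_inter_conn_eq (w : Sym2 V → unitInterval) (s a : V) (X : Set V) :
    (prodBernoulli w).real ({ω : BondConfig V | ∀ x ∈ X, ¬ (openGraph ω).Reachable s x} ∩ openConn s a) =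
      (prodBernoulli w).real {ω : BondConfig V | ∀ x ∈ X, ¬ (openGraph ω).Reachable s x} -
        (prodBernoulli w).real {ω : BondConfig V | ∀ x ∈ insert a X, ¬ (openGraph ω).Reachable s x} := by
  have hsub : {ω : BondConfig V | ∀ x ∈ insert a X, ¬ (openGraph ω).Reachable s x} ⊆
      {ω : BondConfig V | ∀ x ∈ X, ¬ (openGraph ω).Reachable s x} :=
    fun ω hω x hx => hω x (mem_insert_of_mem a hx)
  have h := measureReal_inter_add_sdiff (μ := prodBernoulli w)
    (s := {ω : BondConfig V | ∀ x ∈ X, ¬ (openGraph ω).Reachable s x})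
    (t := {ω : BondConfig V | ∀ x ∈ insert a X, ¬ (openGraph ω).Reachable s x}) MeasurableSet.of_discrete
  rw [inter_eq_right.2 hsub] at h
  rw [avoid_inter_conn_eq_diff]
  linarith

/-- **`μ(D ∩ {s↔a} ∩ {s↔t}) = K_X − K_{X∪{a}} − K_{X∪{t}} + K_{X∪{a,t}}`** (inclusion–exclusion on the avoidance events). [folklore] -/
theorem real_avoid_inter_conn_inter_conn_eq (w : Sym2 V → unitInterval) (s a t : V) (X : Set V) :
    (prodBernoulli w).real ({ω : BondConfig V | ∀ x ∈ X, ¬ (openGraph ω).Reachable s x} ∩ openConn s a ∩ openConn s t) =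
      (prodBernoulli w).real {ω : BondConfig V | ∀ x ∈ X, ¬ (openGraph ω).Reachable s x} -
        (prodBernoulli w).real {ω : BondConfig V | ∀ x ∈ insert a X, ¬ (openGraph ω).Reachable s x} -
        (prodBernoulli w).real {ω : BondConfig V | ∀ x ∈ insert t X, ¬ (openGraph ω).Reachable s x} +
        (prodBernoulli w).real {ω : BondConfig V | ∀ x ∈ insert a (insert t X), ¬ (openGraph ω).Reachable s x} := by
  classical
  set μ := prodBernoulli w with hμ
  -- `D ∩ {s↔a} ∩ {s↔t} = (D ∩ {s↔t}) ∩ {s↔a}` and `D ∩ {s↔t} = R_X ∖ R_{X∪t}`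
  have e1 : ({ω : BondConfig V | ∀ x ∈ X, ¬ (openGraph ω).Reachable s x} ∩ openConn s a ∩ openConn s t) =
      ({ω : BondConfig V | ∀ x ∈ X, ¬ (openGraph ω).Reachable s x} ∩ openConn s a) \
        ({ω : BondConfig V | ∀ x ∈ insert t X, ¬ (openGraph ω).Reachable s x} ∩ openConn s a) := by
    ext ω
    constructor
    · rintro ⟨⟨hX, ha⟩, ht⟩
      exact ⟨⟨hX, ha⟩, fun h => h.1 t (mem_insert t X) ht⟩
    · rintro ⟨⟨hX, ha⟩, h⟩
      refine ⟨⟨hX, ha⟩, ?_⟩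
      by_contra hnt
      apply h
      refine ⟨fun x hx => ?_, ha⟩
      rcases mem_insert_iff.1 hx with rfl | hx'
      · exact hnt
      · exact hX x hx'
  have hsub : ({ω : BondConfig V | ∀ x ∈ insert t X, ¬ (openGraph ω).Reachable s x} ∩ openConn s a) ⊆
      ({ω : BondConfig V | ∀ x ∈ X, ¬ (openGraph ω).Reachable s x} ∩ openConn s a) :=
    fun ω hω => ⟨fun x hx => hω.1 x (mem_insert_of_mem t hx), hω.2⟩
  have h := measureReal_inter_add_sdiff (μ := μ)
    (s := {ω : BondConfig V | ∀ x ∈ X, ¬ (openGraph ω).Reachable s x} ∩ openConn s a)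
    (t := {ω : BondConfig V | ∀ x ∈ insert t X, ¬ (openGraph ω).Reachable s x} ∩ openConn s a) MeasurableSet.of_discrete
  rw [inter_eq_right.2 hsub] at h
  rw [e1]
  have ha1 := real_avoid_inter_conn_eq w s a X
  have ha2 := real_avoid_inter_conn_eq w s a (insert t X)
  change μ.real ({ω : BondConfig V | ∀ x ∈ X, ¬ (openGraph ω).Reachable s x} ∩ openConn s a) = _ at ha1
  change μ.real ({ω : BondConfig V | ∀ x ∈ insert t X, ¬ (openGraph ω).Reachable s x} ∩ openConn s a) = _ at ha2
  linarith

/-- **The vertex-functional covariance is a 2×2 minor of the avoidance kernel**: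
`μ(D)·μ(D ∩ {s↔a} ∩ {s↔t}) − μ(D ∩ {s↔a})·μ(D ∩ {s↔t}) = K_X·K_{X∪{a,t}} − K_{X∪{a}}·K_{X∪{t}}`, `D = {s↮X}`, `K_A = μ(s↮A)`
(`= μ(D)²·Cov(1{s↔a}, 1{s↔t} | s↮X)`; nonnegative by BHK Thm 1.1, not used).
[cite: VandenbergHaggstromKahn2005, Thm. 1.1 (p. 3) — bookkeeping identity, derived here] -/
theorem covD_connIndicator_eq_minor (w : Sym2 V → unitInterval) (s a t : V) (X : Set V) :
    (prodBernoulli w).real {ω : BondConfig V | ∀ x ∈ X, ¬ (openGraph ω).Reachable s x} *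
        (prodBernoulli w).real ({ω : BondConfig V | ∀ x ∈ X, ¬ (openGraph ω).Reachable s x} ∩ openConn s a ∩ openConn s t) -
      (prodBernoulli w).real ({ω : BondConfig V | ∀ x ∈ X, ¬ (openGraph ω).Reachable s x} ∩ openConn s a) *
        (prodBernoulli w).real ({ω : BondConfig V | ∀ x ∈ X, ¬ (openGraph ω).Reachable s x} ∩ openConn s t) =
    (prodBernoulli w).real {ω : BondConfig V | ∀ x ∈ X, ¬ (openGraph ω).Reachable s x} *
        (prodBernoulli w).real {ω : BondConfig V | ∀ x ∈ insert a (insert t X), ¬ (openGraph ω).Reachable s x} -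
      (prodBernoulli w).real {ω : BondConfig V | ∀ x ∈ insert a X, ¬ (openGraph ω).Reachable s x} *
        (prodBernoulli w).real {ω : BondConfig V | ∀ x ∈ insert t X, ¬ (openGraph ω).Reachable s x} := by
  rw [real_avoid_inter_conn_inter_conn_eq, real_avoid_inter_conn_eq w s a X, real_avoid_inter_conn_eq w s t X]
  ring

/-- **MDL(X)′ at the vertex functional `1{s↔a}` ⟺ AEMD(a)** (avoidance-enlargement marker dominance): the `Consts.MDLXJoint` inequality
at `F = connIndicatorFn s a` holds iff `μ(T∩W)·[K_X K_{X∪{a,y}} − K_{X∪a} K_{X∪y}] ≤ μ(T)·[K_X K_{X∪{a,z}} − K_{X∪a} K_{X∪z}]`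
(`T = {y↮{s}∪X} ∩ {s↮X}`, `W = {y↔z}`, `K_A = μ(s↮A)`), i.e. iff
`[P(s↮z | s↮X∪a) − P(s↮z | s↮X)]·P(T) ≥ [P(s↮y | s↮X∪a) − P(s↮y | s↮X)]·P(T ∩ W)`.
[cite: VandenbergHaggstromKahn2005, Thm. 1.1 (p. 3), §2.1 (pp. 9–13) — reformulation, derived here] -/
theorem mdlxJoint_at_connIndicator_iff_minor (w : Sym2 V → unitInterval) (s a y z : V) (X : Set V) :
    ((prodBernoulli w).real ({ω : BondConfig V | ∀ x ∈ insert s X, ¬ (openGraph ω).Reachable y x} ∩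
          {ω | ∀ x ∈ X, ¬ (openGraph ω).Reachable s x} ∩ openConn y z) *
        ((prodBernoulli w).real {ω : BondConfig V | ∀ x ∈ X, ¬ (openGraph ω).Reachable s x} *
            (∫ ω in {ω : BondConfig V | ∀ x ∈ X, ¬ (openGraph ω).Reachable s x} ∩ openConn s y,
              connIndicatorFn s a (openEdgeCluster ω s) ∂(prodBernoulli w)) -
          (∫ ω in {ω : BondConfig V | ∀ x ∈ X, ¬ (openGraph ω).Reachable s x},
              connIndicatorFn s a (openEdgeCluster ω s) ∂(prodBernoulli w)) *
            (prodBernoulli w).real ({ω : BondConfig V | ∀ x ∈ X, ¬ (openGraph ω).Reachable s x} ∩ openConn s y)) ≤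
      (prodBernoulli w).real ({ω : BondConfig V | ∀ x ∈ insert s X, ¬ (openGraph ω).Reachable y x} ∩
          {ω | ∀ x ∈ X, ¬ (openGraph ω).Reachable s x}) *
        ((prodBernoulli w).real {ω : BondConfig V | ∀ x ∈ X, ¬ (openGraph ω).Reachable s x} *
            (∫ ω in {ω : BondConfig V | ∀ x ∈ X, ¬ (openGraph ω).Reachable s x} ∩ openConn s z,
              connIndicatorFn s a (openEdgeCluster ω s) ∂(prodBernoulli w)) -
          (∫ ω in {ω : BondConfig V | ∀ x ∈ X, ¬ (openGraph ω).Reachable s x},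
              connIndicatorFn s a (openEdgeCluster ω s) ∂(prodBernoulli w)) *
            (prodBernoulli w).real ({ω : BondConfig V | ∀ x ∈ X, ¬ (openGraph ω).Reachable s x} ∩ openConn s z))) ↔
    (prodBernoulli w).real ({ω : BondConfig V | ∀ x ∈ insert s X, ¬ (openGraph ω).Reachable y x} ∩
          {ω | ∀ x ∈ X, ¬ (openGraph ω).Reachable s x} ∩ openConn y z) *
        ((prodBernoulli w).real {ω : BondConfig V | ∀ x ∈ X, ¬ (openGraph ω).Reachable s x} *
            (prodBernoulli w).real {ω : BondConfig V | ∀ x ∈ insert a (insert y X), ¬ (openGraph ω).Reachable s x} -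
          (prodBernoulli w).real {ω : BondConfig V | ∀ x ∈ insert a X, ¬ (openGraph ω).Reachable s x} *
            (prodBernoulli w).real {ω : BondConfig V | ∀ x ∈ insert y X, ¬ (openGraph ω).Reachable s x}) ≤
      (prodBernoulli w).real ({ω : BondConfig V | ∀ x ∈ insert s X, ¬ (openGraph ω).Reachable y x} ∩
          {ω | ∀ x ∈ X, ¬ (openGraph ω).Reachable s x}) *
        ((prodBernoulli w).real {ω : BondConfig V | ∀ x ∈ X, ¬ (openGraph ω).Reachable s x} *
            (prodBernoulli w).real {ω : BondConfig V | ∀ x ∈ insert a (insert z X), ¬ (openGraph ω).Reachable s x} -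
          (prodBernoulli w).real {ω : BondConfig V | ∀ x ∈ insert a X, ¬ (openGraph ω).Reachable s x} *
            (prodBernoulli w).real {ω : BondConfig V | ∀ x ∈ insert z X, ¬ (openGraph ω).Reachable s x}) := by
  classical
  set μ := prodBernoulli w with hμ
  set D : Set (BondConfig V) := {ω | ∀ x ∈ X, ¬ (openGraph ω).Reachable s x} with hD
  simp_rw [connIndicatorFn_openEdgeCluster]
  rw [KNPreFKG.setIntegral_indicator_one_eq, KNPreFKG.setIntegral_indicator_one_eq,
    KNPreFKG.setIntegral_indicator_one_eq]
  have ey : D ∩ openConn s y ∩ openConn s a = D ∩ openConn s a ∩ openConn s y := inter_right_comm D _ _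
  have ez : D ∩ openConn s z ∩ openConn s a = D ∩ openConn s a ∩ openConn s z := inter_right_comm D _ _
  rw [ey, ez, ← covD_connIndicator_eq_minor w s a y X, ← covD_connIndicator_eq_minor w s a z X]

end Consts

end Summit.CriticalPhenomena.PercolationContinuityZ3.Theorems

end
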